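import Summits.RiemannHypothesis.RiemannHypothesis.Theorems.Splittings.ScrewKreinDiscreteExact
import Summits.RiemannHypothesis.RiemannHypothesis.Theorems.IntegerScrewFiniteExceptionInertia

/-!
# Screw index transfer, discrete Kreĭn core (5d/4+4): PARITY LAWS, the determinant door, and node universality

rh-split-screw-bridge g8, lane (xii-d)/(xii-e) continuation «PARITY», file 5d (imports file 5c `ScrewKreinDiscreteExact` and the tree's
`IntegerScrewFiniteExceptionInertia`).  All statements are corollaries of the EXACT INDEX THEOREM of file 5c
(`negIndex_eventually_eq_ncard_rightZeros`: for `rightZeros` finite, `n₋(S_n) = #rightZeros` for all large `n`) and of ONE new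
elementary input: complex conjugation is a fixed-point-free involution of `rightZeros` (functional equation + no real zeros of `ζ` in
`(0,1)`), so `#rightZeros` is EVEN.

* §19 `even_card_of_conj_closed`, `even_ncard_rightZeros` : `rightZeros.Finite → Even rightZeros.ncard`.
* §20 graded count: `indexBounded_iff_ncard_le` : `(∀ n, n₋(S_n) ≤ K) ↔ rightZeros.Finite ∧ #rightZeros ≤ K`;
  `indexBounded_odd_iff` : the bound `2j+1` is the bound `2j`; `rh_iff_rightZeros_eq_empty`;
  **`rh_iff_negIndex_le_one` : RH ⟺ every screw matrix has AT MOST ONE negative eigenvalue** (Suzuki's criterion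
  `rh_iff_negIndex_eq_zero` asks for none); `rh_iff_eventually_negIndex_le_one`.
* §21 `eventually_negIndex_ne_one` : UNCONDITIONALLY the screw negative index is eventually `≠ 1` (index one is a transient state).
* §22 the determinant door: `screwDet_pos_eventually_of_foz` : FOZ ⟹ `det S_n > 0` for all large `n` (tree: `≠ 0`,
  `ScrewNullComb.fozNonsingular_of_foz`; the SIGN is the parity law); **`edet_iff_foz` : (∃ N, ∀ n ≥ N, 0 < det S_n) ⟺ FOZ** and
  `edet_iff_etail` — the determinant ∃-tail is the pivot ∃-tail is FOZ, unconditionally (compare the tree's fixed-order statements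
  `CostumeDetectorsScrewIII.detPos_iff_rh : (∀ n, 0 < det S_n) ⟺ RH` and `rh_iff_detNonneg_and_detNonzero`, whose «parity loophole
  n₋ ∈ 2ℕ» is here realised: `screwDet_nonneg_eventually_of_foz`).
* §23 node universality: `gram_negIndex_screwNodes` (the screw matrices ARE Gram matrices of the kernel), `gram_indexBounded_iff` :
  a uniform bound on the negative inertia of `[G(x_p,x_q)]` over ALL finite real node sets is the same as over the log-integer ladder;
  `isGreatest_gramNegIndex` : for `rightZeros` finite the number of negative squares of Suzuki's kernel `G` on `ℝ` (the supremum of the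
  negative inertia of its Gram matrices) IS `#rightZeros`; `gram_negIndex_unbounded` (infinite case);
  **`rh_iff_gram_negIndex_le_one` : RH ⟺ no finite real node configuration sees two negative squares** (graded form of
  Suzuki2023 Thm 1.2 = tree `Suzuki2023_thm12_holds`, which asks for none).

Classification tags: [folklore] = standard; [new-combination] = assembled here.
HONEST LABEL: SPLITTING SEARCH over kernel-typed RH-EQUIVALENCES; these statements relate OPEN tail data (screw negative index,
determinant signs, off-line zero counts) to each other and decide none of them; `rh_iff_negIndex_le_one` / `rh_iff_gram_negIndex_le_one`
are RH-EQUIVALENCES, not evidence; nothing here bears on the truth of RH.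
-/

noncomputable section

set_option linter.dupNamespace false

namespace Summit.RiemannHypothesis.RiemannHypothesis.Theorems.Splittings.ScrewKreinDiscrete

open Finset Complex MeasureTheory Set Filter Topology Polynomial Module
open scoped ComplexConjugate Matrix
open Literature.NumberTheory.LFunctions
open Literature.Analysis.OperatorTheory
open Literature.Analysis.OperatorTheory.KreinStewart
open Summit.RiemannHypothesis.RiemannHypothesis.Theses.RuelleBand
open Summit.RiemannHypothesis.RiemannHypothesis.Theorems.IntegerScrew
open Summit.RiemannHypothesis.RiemannHypothesis.Theorems.Splittings.ScrewKreinCore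
open Summit.RiemannHypothesis.RiemannHypothesis.Theorems.Splittings.ScrewIndexTransferKrein

/-! ## §19 PARITY: `#rightZeros` is even -/

/-- A finite set of complex numbers closed under conjugation and containing no real point has even cardinality
(conjugation is a fixed-point-free involution; remove a pair and induct). [folklore] -/
theorem even_card_of_conj_closed :
    ∀ s : Finset ℂ, (∀ w ∈ s, conj w ∈ s) → (∀ w ∈ s, conj w ≠ w) → Even s.card := by
  intro s
  induction s using Finset.strongInduction with
  | H s ih =>
    intro h1 h2
    rcases s.eq_empty_or_nonempty with rfl | ⟨w, hw⟩
    · simp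
    · have hcw : conj w ∈ s.erase w := Finset.mem_erase.mpr ⟨h2 w hw, h1 w hw⟩
      set t : Finset ℂ := (s.erase w).erase (conj w) with ht
      have htsub : t ⊆ s := fun z hz => Finset.mem_of_mem_erase (Finset.mem_of_mem_erase hz)
      have htss : t ⊂ s := by
        refine Finset.ssubset_iff_subset_ne.mpr ⟨htsub, fun h => ?_⟩
        have : w ∈ t := h ▸ hw
        simp [ht] at this
      have hcard : s.card = t.card + 2 := by
        have h₁ := Finset.card_erase_of_mem hcw
        have h₂ := Finset.card_erase_of_mem hw
        have h₃ : 0 < (s.erase w).card := Finset.card_pos.mpr ⟨_, hcw⟩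
        rw [ht]; omega
      have ht1 : ∀ z ∈ t, conj z ∈ t := by
        intro z hz
        have hz' := hz
        simp only [ht, Finset.mem_erase] at hz' ⊢
        obtain ⟨hzc, hzw, hzs⟩ := hz'
        refine ⟨fun h => hzw ?_, fun h => hzc ?_, h1 z hzs⟩
        · have := congrArg conj h
          simpa using this
        · rw [← h]; simp
      have ht2 : ∀ z ∈ t, conj z ≠ z := fun z hz => h2 z (htsub hz)
      obtain ⟨m, hm⟩ := ih t htss ht1 ht2
      exact ⟨m + 1, by omega⟩

/-- **PARITY LAW.**  If `rightZeros = {w : Re w > 0, ξ(½ + w) = 0}` is finite, its cardinality is EVEN: `w ↦ w̄` is an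
involution of it (`conj_mem_rightZeros`, functional equation) without fixed points (`im_ne_zero_of_mem_rightZeros`: no real zeros
of `ζ` in `(0,1)`).  Hence the eventual screw negative index `K⋆ = #rightZeros` is even. [new-combination] -/
theorem even_ncard_rightZeros (hfin : rightZeros.Finite) : Even rightZeros.ncard := by
  rw [Set.ncard_eq_toFinset_card rightZeros hfin]
  refine even_card_of_conj_closed _ (fun w hw => ?_) (fun w hw => ?_)
  · exact hfin.mem_toFinset.mpr (conj_mem_rightZeros (hfin.mem_toFinset.mp hw))
  · intro h
    exact im_ne_zero_of_mem_rightZeros (hfin.mem_toFinset.mp hw) (Complex.conj_eq_iff_im.mp h)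

/-- The eventual screw index is even (finite case). [new-combination] -/
theorem eventually_even_negIndex (hfin : rightZeros.Finite) :
    ∃ N : ℕ, ∀ n : ℕ, N ≤ n → Even (univ.filter fun i => (screwMatrix_isHermitian n).eigenvalues i < 0).card := by
  obtain ⟨N, hN⟩ := negIndex_eventually_eq_ncard_rightZeros hfin
  exact ⟨N, fun n hn => by rw [hN n hn]; exact even_ncard_rightZeros hfin⟩

/-! ## §20 THE GRADED COUNT and `RH ⟺ n₋(S_n) ≤ 1` -/

/-- **Graded exact count**: a uniform bound `n₋(S_n) ≤ K` holds iff `rightZeros` is finite with at most `K` points.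
[new-combination] -/
theorem indexBounded_iff_ncard_le (K : ℕ) :
    (∀ n : ℕ, (univ.filter fun i => (screwMatrix_isHermitian n).eigenvalues i < 0).card ≤ K) ↔
      rightZeros.Finite ∧ rightZeros.ncard ≤ K :=
  ⟨fun hK => ⟨rightZeros_finite K hK, ncard_rightZeros_le_of_indexBounded K hK⟩,
    fun h n => (negIndex_le_ncard_rightZeros h.1 n).trans h.2⟩

/-- Odd bounds are not sharper than the even bound below them: `(∀ n, n₋ ≤ 2j+1) ⟺ (∀ n, n₋ ≤ 2j)` (parity law).
[new-combination] -/
theorem indexBounded_odd_iff (j : ℕ) :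
    (∀ n : ℕ, (univ.filter fun i => (screwMatrix_isHermitian n).eigenvalues i < 0).card ≤ 2 * j + 1) ↔
      (∀ n : ℕ, (univ.filter fun i => (screwMatrix_isHermitian n).eigenvalues i < 0).card ≤ 2 * j) := by
  rw [indexBounded_iff_ncard_le, indexBounded_iff_ncard_le]
  constructor
  · rintro ⟨hfin, hle⟩
    obtain ⟨m, hm⟩ := even_ncard_rightZeros hfin
    exact ⟨hfin, by omega⟩
  · rintro ⟨hfin, hle⟩
    exact ⟨hfin, by omega⟩

/-- `RH ⟺ rightZeros = ∅` (through the tree's index criterion `ScrewBridgeRungs.rh_iff_negIndex_eq_zero` and the exact count).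
[folklore] -/
theorem rh_iff_rightZeros_eq_empty : _root_.RiemannHypothesis ↔ rightZeros = ∅ := by
  rw [ScrewBridgeRungs.rh_iff_negIndex_eq_zero]
  constructor
  · intro h0
    have hK : ∀ n : ℕ, (univ.filter fun i => (screwMatrix_isHermitian n).eigenvalues i < 0).card ≤ 0 :=
      fun n => (h0 n).le
    obtain ⟨hfin, hle⟩ := (indexBounded_iff_ncard_le 0).mp hK
    exact (Set.ncard_eq_zero hfin).mp (Nat.le_zero.mp hle)
  · intro h n
    have hfin : rightZeros.Finite := by rw [h]; exact Set.finite_empty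
    have := negIndex_le_ncard_rightZeros hfin n
    rw [h, Set.ncard_empty] at this
    exact Nat.le_zero.mp this

/-- **`RH ⟺ every screw matrix has AT MOST ONE negative eigenvalue.`**  Suzuki's criterion (tree `rh_iff_negIndex_eq_zero`)
asks for NO negative eigenvalue; by the exact count and the parity law a single off-line zero already forces `n₋(S_n) ≥ 2`
eventually, so the bound `1` suffices.  An RH-EQUIVALENCE, not evidence. [new-combination] -/
theorem rh_iff_negIndex_le_one :
    _root_.RiemannHypothesis ↔ ∀ n : ℕ, (univ.filter fun i => (screwMatrix_isHermitian n).eigenvalues i < 0).card ≤ 1 := by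
  have h := indexBounded_odd_iff 0
  simp only [mul_zero, zero_add, Nat.le_zero] at h
  rw [h]
  exact ScrewBridgeRungs.rh_iff_negIndex_eq_zero

/-- Eventual form (monotonicity of `n₋`): `RH ⟺ ∃ N, ∀ n ≥ N, n₋(S_n) ≤ 1`. [new-combination] -/
theorem rh_iff_eventually_negIndex_le_one :
    _root_.RiemannHypothesis ↔
      ∃ N : ℕ, ∀ n : ℕ, N ≤ n → (univ.filter fun i => (screwMatrix_isHermitian n).eigenvalues i < 0).card ≤ 1 := by
  rw [rh_iff_negIndex_le_one]
  refine ⟨fun h => ⟨0, fun n _ => h n⟩, fun ⟨N, hN⟩ n => ?_⟩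
  exact (ScrewBridgeRawG3.negIndex_mono (le_max_left n N)).trans (hN _ (le_max_right n N))

/-! ## §21 UNCONDITIONAL: index one is transient -/

/-- **Unconditionally, `n₋(S_n) ≠ 1` for all large `n`.**  Finite case: the index freezes at the even number `#rightZeros`;
infinite case: it is unbounded and monotone.  (So the screw ladder is eventually in the state `n₋ = 0` — iff RH — or in states
`n₋ ≥ 2`.) [new-combination] -/
theorem eventually_negIndex_ne_one :
    ∃ N : ℕ, ∀ n : ℕ, N ≤ n → (univ.filter fun i => (screwMatrix_isHermitian n).eigenvalues i < 0).card ≠ 1 := by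
  by_cases hfin : rightZeros.Finite
  · obtain ⟨N, hN⟩ := negIndex_eventually_eq_ncard_rightZeros hfin
    obtain ⟨m, hm⟩ := even_ncard_rightZeros hfin
    exact ⟨N, fun n hn => by rw [hN n hn]; omega⟩
  · obtain ⟨n₀, hn₀⟩ := negIndex_unbounded_of_infinite hfin 1
    exact ⟨n₀, fun n hn => by have := ScrewBridgeRawG3.negIndex_mono hn; omega⟩

/-- Equivalent phrasing: eventually `n₋(S_n) = 0 ∨ 2 ≤ n₋(S_n)`. [new-combination] -/
theorem eventually_negIndex_zero_or_two_le :
    ∃ N : ℕ, ∀ n : ℕ, N ≤ n →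
      (univ.filter fun i => (screwMatrix_isHermitian n).eigenvalues i < 0).card = 0 ∨
        2 ≤ (univ.filter fun i => (screwMatrix_isHermitian n).eigenvalues i < 0).card := by
  obtain ⟨N, hN⟩ := eventually_negIndex_ne_one
  exact ⟨N, fun n hn => by have := hN n hn; omega⟩

/-! ## §22 THE DETERMINANT DOOR: `(∃ N, ∀ n ≥ N, det S_n > 0) ⟺ FOZ` -/

/-- `rightZeros` finite ⟹ FOZ (file 5c / tree `indexBounded_iff_foz`). [new-combination] -/
theorem foz_of_rightZeros_finite (hfin : rightZeros.Finite) : CofiniteCriticalLine :=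
  indexBounded_iff_foz.mp (indexBounded_iff_rightZeros_finite.mpr hfin)

/-- FOZ ⟹ `rightZeros` finite. [new-combination] -/
theorem rightZeros_finite_of_foz (hfoz : CofiniteCriticalLine) : rightZeros.Finite :=
  indexBounded_iff_rightZeros_finite.mp (indexBounded_iff_foz.mpr hfoz)

/-- **FOZ ⟹ the screw determinants are eventually POSITIVE.**  The tree has «eventually non-zero»
(`ScrewNullComb.fozNonsingular_of_foz`); the sign is `(−1)^{n₋(S_n)}` (`screwDet_pos_iff_even_card_neg`) and `n₋(S_n)` is eventually
the even number `#rightZeros`. [new-combination] -/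
theorem screwDet_pos_eventually_of_foz (hfoz : CofiniteCriticalLine) : ∃ N : ℕ, ∀ n : ℕ, N ≤ n → 0 < screwDet n := by
  obtain ⟨N₁, hN₁⟩ := ScrewNullComb.fozNonsingular_of_foz hfoz
  have hfin := rightZeros_finite_of_foz hfoz
  obtain ⟨N₂, hN₂⟩ := negIndex_eventually_eq_ncard_rightZeros hfin
  refine ⟨max N₁ N₂, fun n hn => ?_⟩
  rw [screwDet_pos_iff_even_card_neg n (ScrewBridgeRaw.eigenvalues_ne_zero_of_screwDet_ne_zero (hN₁ n (le_of_max_le_left hn))),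
    hN₂ n (le_of_max_le_right hn)]
  exact even_ncard_rightZeros hfin

/-- FOZ ⟹ the screw determinants are eventually `≥ 0` (the «parity loophole n₋ ∈ 2ℕ» of the determinant axis, realised: the weak
determinant tail is FOZ-implied, hence not RH-strength unless FOZ ⟹ RH). [new-combination] -/
theorem screwDet_nonneg_eventually_of_foz (hfoz : CofiniteCriticalLine) : ∃ N : ℕ, ∀ n : ℕ, N ≤ n → 0 ≤ screwDet n :=
  (screwDet_pos_eventually_of_foz hfoz).imp fun _ h n hn => (h n hn).le

/-- **THE DETERMINANT DOOR `EDET ⟺ FOZ`.**  The screw determinants are eventually positive iff all but finitely many non-trivial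
zeros of `ζ` lie on the critical line.  (`⟹`: ratios of positive determinants are positive pivots, then the tree's unconditional
`etail_iff_foz`; `⟸`: `screwDet_pos_eventually_of_foz`.)  Neither side is RH; compare `detPos_iff_rh` (ALL orders) in the tree.
[new-combination] -/
theorem edet_iff_foz : (∃ N : ℕ, ∀ n : ℕ, N ≤ n → 0 < screwDet n) ↔ CofiniteCriticalLine := by
  refine ⟨fun ⟨N, hN⟩ => etail_iff_foz.mp ⟨N + 2, fun M hM => ?_⟩, screwDet_pos_eventually_of_foz⟩
  obtain ⟨m, rfl⟩ : ∃ m, M = m + 2 := ⟨M - 2, by omega⟩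
  rw [screwPivot_add_two]
  exact div_pos (hN _ (by omega)) (hN _ (by omega))

/-- `EDET ⟺ ETAIL`: the determinant ∃-tail and the pivot ∃-tail of the screw ladder are the same statement. [new-combination] -/
theorem edet_iff_etail :
    (∃ N : ℕ, ∀ n : ℕ, N ≤ n → 0 < screwDet n) ↔ (∃ M₀ : ℕ, ∀ M : ℕ, M₀ ≤ M → 0 < screwPivot M) :=
  edet_iff_foz.trans etail_iff_foz.symm

/-- `EDET ⟺ IndexBounded ⟺ rightZeros finite`. [new-combination] -/
theorem edet_iff_rightZeros_finite : (∃ N : ℕ, ∀ n : ℕ, N ≤ n → 0 < screwDet n) ↔ rightZeros.Finite :=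
  edet_iff_foz.trans ⟨rightZeros_finite_of_foz, foz_of_rightZeros_finite⟩

/-! ## §23 NODE UNIVERSALITY: the number of negative squares of `G` on `ℝ` is `#rightZeros` -/

/-- The screw matrices ARE Gram matrices of the kernel, at the nodes `log 2, …, log(n+1)`; in particular their negative inertia is
that of a Gram matrix. [folklore] -/
theorem gram_negIndex_screwNodes (n : ℕ) :
    (univ.filter fun i =>
        (kernelMatrix_isHermitian n (fun i : Fin n => Real.log (((i : ℕ) + 2 : ℕ) : ℝ))).eigenvalues i < 0).card =
      (univ.filter fun i => (screwMatrix_isHermitian n).eigenvalues i < 0).card := rfl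

/-- **Node universality of index bounds**: the Gram matrices `[G(x_p,x_q)]` over ALL finite real node sets have negative inertia
`≤ K` iff the log-integer screw ladder does (`⟸` is file 5b's `negIndex_kernelMatrix_le`, the free node `0` + atomic witnesses;
`⟹` is specialisation). [new-combination] -/
theorem gram_indexBounded_iff (K : ℕ) :
    (∀ (r : ℕ) (x : Fin r → ℝ), (univ.filter fun i => (kernelMatrix_isHermitian r x).eigenvalues i < 0).card ≤ K) ↔
      ∀ n : ℕ, (univ.filter fun i => (screwMatrix_isHermitian n).eigenvalues i < 0).card ≤ K :=
  ⟨fun h n => by rw [← gram_negIndex_screwNodes]; exact h n _, fun h r x => negIndex_kernelMatrix_le K h r x⟩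

/-- Every Gram matrix of the kernel at real nodes has at most `#rightZeros` negative eigenvalues (finite case). [new-combination] -/
theorem gram_negIndex_le_ncard_rightZeros (hfin : rightZeros.Finite) (r : ℕ) (x : Fin r → ℝ) :
    (univ.filter fun i => (kernelMatrix_isHermitian r x).eigenvalues i < 0).card ≤ rightZeros.ncard :=
  negIndex_kernelMatrix_le rightZeros.ncard (negIndex_le_ncard_rightZeros hfin) r x

/-- **THE NUMBER OF NEGATIVE SQUARES OF SUZUKI'S KERNEL ON `ℝ` IS `#rightZeros`** (finite case): `#rightZeros` is the GREATEST
negative inertia of a Gram matrix `[G(x_p,x_q)]` over all finite real node configurations — attained on the log-integer ladder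
(exact index theorem), never exceeded (node universality).  In Kreĭn–Langer language: `−Ψ` has exactly `κ = #rightZeros` negative
squares on `ℝ`. [new-combination] -/
theorem isGreatest_gramNegIndex (hfin : rightZeros.Finite) :
    IsGreatest {k : ℕ | ∃ (r : ℕ) (x : Fin r → ℝ),
        (univ.filter fun i => (kernelMatrix_isHermitian r x).eigenvalues i < 0).card = k} rightZeros.ncard := by
  obtain ⟨N, hN⟩ := negIndex_eventually_eq_ncard_rightZeros hfin
  refine ⟨⟨N, _, (gram_negIndex_screwNodes N).trans (hN N le_rfl)⟩, ?_⟩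
  rintro k ⟨r, x, rfl⟩
  exact gram_negIndex_le_ncard_rightZeros hfin r x

/-- Infinite case: the negative inertia of the Gram matrices is unbounded (already along the screw ladder). [new-combination] -/
theorem gram_negIndex_unbounded (hinf : rightZeros.Infinite) (K : ℕ) :
    ∃ (r : ℕ) (x : Fin r → ℝ), K < (univ.filter fun i => (kernelMatrix_isHermitian r x).eigenvalues i < 0).card := by
  obtain ⟨n, hn⟩ := negIndex_unbounded_of_infinite hinf K
  exact ⟨n, _, by rw [gram_negIndex_screwNodes]; exact hn⟩

/-- `(∀ nodes, Gram negative inertia ≤ K) ⟺ rightZeros finite with ≤ K points` — the graded, node-free form of the exact count.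
[new-combination] -/
theorem gram_indexBounded_iff_ncard_le (K : ℕ) :
    (∀ (r : ℕ) (x : Fin r → ℝ), (univ.filter fun i => (kernelMatrix_isHermitian r x).eigenvalues i < 0).card ≤ K) ↔
      rightZeros.Finite ∧ rightZeros.ncard ≤ K :=
  (gram_indexBounded_iff K).trans (indexBounded_iff_ncard_le K)

/-- **Graded Suzuki Thm 1.2: `RH ⟺ no finite real node configuration sees TWO negative squares of `G`.**  (Thm 1.2 itself —
none at all — is the tree's `Suzuki2023_thm12_holds`; the bound `1` suffices by the parity law.)  An RH-EQUIVALENCE, not evidence.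
[new-combination] -/
theorem rh_iff_gram_negIndex_le_one :
    _root_.RiemannHypothesis ↔
      ∀ (r : ℕ) (x : Fin r → ℝ), (univ.filter fun i => (kernelMatrix_isHermitian r x).eigenvalues i < 0).card ≤ 1 := by
  rw [gram_indexBounded_iff 1]
  exact rh_iff_negIndex_le_one

/-- `RH ⟺ every Gram matrix of the kernel at real nodes has negative inertia 0` (node-universal form of `rh_iff_negIndex_eq_zero`,
obtained here through the exact count rather than through Suzuki2023 Thm 1.2). [new-combination] -/
theorem rh_iff_gram_negIndex_eq_zero :
    _root_.RiemannHypothesis ↔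
      ∀ (r : ℕ) (x : Fin r → ℝ), (univ.filter fun i => (kernelMatrix_isHermitian r x).eigenvalues i < 0).card = 0 := by
  have h := gram_indexBounded_iff 0
  simp only [Nat.le_zero] at h
  rw [h]
  exact ScrewBridgeRungs.rh_iff_negIndex_eq_zero

end Summit.RiemannHypothesis.RiemannHypothesis.Theorems.Splittings.ScrewKreinDiscrete
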